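/-
Copyright (c) 2026 the pub-hodgecm-mathlib formalisation cell (harness21).  Prover seat hodgecm-mathlib-K2E3-p37 (g0), Track B «K2-LIT» ∕ h413 =
`stmt-HodgeConjecture-24833`, line `K2_E3_EllipticInputs`, unit U4 «Keys», PART «U4Keys» socket :182 (U4f-χ₁-ram-one-pos)
`sig_K2E3KeysThmTwoContractingRamifiedCharOnePosDepth` (LINE-LEAD K2E3-plan (g4) L4∕E3 EMIT #5 deal D163 2026-09-04T15:31:56Z; R0 census + addenda
`K2/K2E3-p37/g0/CENSUS-U4f-PosDepth.K2E3-p37-g0.md`): programme A_pos brick (v)-θ «THE CHARACTER `j ↦ χ₁(j₀₀)` OF THE LEVEL-`n` IWAHORI `J_n` FOR `χ₁` OF CONDUCTOR `≤ n`» —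
the `n`-twin of ★ Z2A-1 `K2E3DepthZeroIwahoriCharacter` (K2E3-p06 (g4)).  REPORT-FIRST 2026-09-04.
-/
import Summits.HodgeConjecture.HodgeConjecture.Theorems.K2E3IwahoriLevelNFactorisation   -- ★ p861548 (this seat): `J_n` test `mem_glInt_inf_conj_glInt_pow_iff`, pivot `v_apply_zero_zero_eq_one_of_mem_inf_pow`
import HarnessLib

/-!
# K2 ∕ E3 «EllipticInputs», unit U4 «Keys» — (U4f-χ₁-ram-one-pos), programme A_pos brick (v)-θ: THE CHARACTER OF THE LEVEL-`n` IWAHORI `J_n` OF `U(σ, Φ₃)(K)` READ OFF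
# THE `(0,0)` ENTRY «`j ↦ χ₁(j₀₀)` is multiplicative on `J_n` for every `χ₁` trivial on `1 + 𝔭ⁿ`»   [Roche1998 §3; MoyPrasad1996 §3; BruhatTits1972 (4.4.4); Casselman1995 §1.4]

Cell hodgecm-mathlib, Track B «K2-LIT», crux item H413 = stmt-HodgeConjecture-24833 (route `HCCMUnconditional`, no route verbs); target BY NAME the OPEN tier-0 leaf
`…K2E3EllipticInputs.U4Keys.sig_K2E3KeysThmTwoContractingRamifiedCharOnePosDepth` (U4Keys ED. 8 :182), design D-I «vanishing functional» at POSITIVE depth.  Author K2E3-p37 (g0).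
`--supports stmt-HodgeConjecture-24833 --as helper`; THEOREMS ONLY (no `def` ∕ `instance` ∕ `notation` ∕ named fact ∕ `sorry`); MODEL level (`U(σ, Φ₃)(K)`, letters
`hvσ hvϖ hJ gn hgn` of ★ p861548).  NOT THE PAYER of :182.

THE POINT.  The type vector of ★ V2b `K2E3TypeVectorOfSubrepFactored.exists_typeVector_of_mem_of_factored` needs a function `θ : G → ℂ` MULTIPLICATIVE on the type group and equal to
the inducing character on its `P`-part.  At depth zero (★ Z2A-1) the type group is `I` and `θ(j) = χ₁(j₀₀)` for `χ₁` trivial on `1 + 𝔭`.  At POSITIVE depth the type group is the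
level-`n` Iwahori `J_n = K₀ ⊓ g_nK₀g_n⁻¹` (★ p861548: entries integral, `|j₂₀|, |j₂₁|, |j₁₀| ≤ |ϖ|ⁿ` — upper triangular modulo `𝔭ⁿ`) and the SAME recipe `θ(j) := χ₁(j₀₀)` works for
every `χ₁` of CONDUCTOR `≤ n` (`χ₁ = 1` on `{u : |u − 1| ≤ |ϖ|ⁿ}`): `j₀₀` is a unit (★ pivot), and `(jj′)₀₀ = j₀₀j′₀₀ + j₀₁j′₁₀ + j₀₂j′₂₀` differs from `j₀₀j′₀₀` by an element
of `𝔭ⁿ` (§1), so `χ₁((jj′)₀₀) = χ₁(j₀₀)χ₁(j′₀₀)` (§2).  `θ = 1` on lower unipotents (`n̄₀₀ = 1`), `θ(p) = χ₁(p₀₀)` on upper triangular `p` (CM dress in the (v)-assembly).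
* §1 `v_mul_apply_zero_zero_sub_le_pow` (`|(jj′)₀₀ − j₀₀j′₀₀| ≤ |ϖ|ⁿ` on `J_n`).
* §2 `chi_mk0_eq_mul_of_v_sub_le_pow` (a character of conductor `≤ n` is determined modulo `𝔭ⁿ` on units), **`chi_apply_zero_zero_mul_pow`** (`χ₁((jj′)₀₀) = χ₁(j₀₀)·χ₁(j′₀₀)`
  on `J_n`, `1 ≤ n`), `apply_zero_zero_ne_zero_of_mem_pow`.
HONEST LABEL: HC_CM is proved only modulo the 7 printed citations (2 remaining named inputs: hLiu418 = stmt-HodgeConjecture-24832, h413 = stmt-HodgeConjecture-24833)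
until rung 0 closes; count-neutral — this file does NOT pay the leaf; no printed citation is discharged.

## References
* [Roche1998] A. Roche, *Types and Hecke algebras for principal series representations of split reductive p-adic groups*, Ann. Sci. ÉNS (4) 31 (1998), §3 (the character `χ̃` of `J_χ`).
* [MoyPrasad1996] A. Moy, G. Prasad, *Jacquet functors and unrefined minimal K-types*, Comment. Math. Helv. 71 (1996), §3.
* [BruhatTits1972] F. Bruhat, J. Tits, *Groupes réductifs sur un corps local I*, Publ. Math. IHÉS 41 (1972), (4.4.4).
* [Casselman1995] W. Casselman, *Introduction to the theory of admissible representations of `p`-adic reductive groups* (1995), §1.4.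
-/

set_option autoImplicit false
-- the mandated namespace has the single-problem summit's repeated segment (`HodgeConjecture.HodgeConjecture`)
set_option linter.dupNamespace false

noncomputable section

open Matrix Literature.NumberTheory.Automorphic Literature.NumberTheory.Automorphic.UnitaryGroup
open scoped Matrix MatrixGroups WithZero

namespace Summit.HodgeConjecture.HodgeConjecture.Cruxes.H413.K2E3LevelNIwahoriCharacter

open Summit.HodgeConjecture.HodgeConjecture.Cruxes.H413

variable {K : Type*} [Field K] [Valued K ℤᵐ⁰] [ValuativeRel K] [(Valued.v : Valuation K ℤᵐ⁰).Compatible]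
  (σ : K →+* K) {ϖ : K} {J : Matrix (Fin 3) (Fin 3) K} (hJ : J = (StdForm.antidiagonal 3).over K)
  (hvσ : ∀ a, Valued.v (σ a) = Valued.v a) (hvϖ : Valued.v ϖ = WithZero.exp (-1 : ℤ))
  {n : ℕ} (gn : GL (Fin 3) K) (hgn : (gn : Matrix (Fin 3) (Fin 3) K) = Matrix.diagonal ![(1 : K), 1, ϖ ^ n])

/-! ## §1 The `(0,0)` entry on `J_n` is multiplicative modulo `𝔭ⁿ` -/

include hJ hvσ hvϖ hgn in
/-- **`|(j j′)₀₀ − j₀₀ j′₀₀| ≤ |ϖ|ⁿ` for `j, j′ ∈ J_n`**: `(jj′)₀₀ = j₀₀j′₀₀ + j₀₁j′₁₀ + j₀₂j′₂₀` with `|j₀ₖ| ≤ 1` (integrality) and `|j′₁₀|, |j′₂₀| ≤ |ϖ|ⁿ` (the level-`n` test ★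
`mem_glInt_inf_conj_glInt_pow_iff`: `J_n` is upper triangular modulo `𝔭ⁿ`). [cite: BruhatTits1972, (4.4.4)] [cite: Roche1998, §3] -/
theorem v_mul_apply_zero_zero_sub_le_pow {j j' : ↥(unitaryGroupOfForm σ J)}
    (hj : j ∈ (glInt 3 K).subgroupOf (unitaryGroupOfForm σ J) ⊓ ((glInt 3 K).map (MulAut.conj gn).toMonoidHom).subgroupOf (unitaryGroupOfForm σ J))
    (hj' : j' ∈ (glInt 3 K).subgroupOf (unitaryGroupOfForm σ J) ⊓ ((glInt 3 K).map (MulAut.conj gn).toMonoidHom).subgroupOf (unitaryGroupOfForm σ J)) :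
    Valued.v ((((j * j' : ↥(unitaryGroupOfForm σ J)) : GL (Fin 3) K) : Matrix (Fin 3) (Fin 3) K) 0 0 -
      (((j : GL (Fin 3) K) : Matrix (Fin 3) (Fin 3) K) 0 0) * (((j' : GL (Fin 3) K) : Matrix (Fin 3) (Fin 3) K) 0 0)) ≤ Valued.v ϖ ^ n := by
  obtain ⟨hint, -, -, -⟩ := (K2E3IwahoriLevelNFactorisation.mem_glInt_inf_conj_glInt_pow_iff σ hJ hvσ hvϖ gn hgn j).1 hj
  obtain ⟨-, h20', -, h10'⟩ := (K2E3IwahoriLevelNFactorisation.mem_glInt_inf_conj_glInt_pow_iff σ hJ hvσ hvϖ gn hgn j').1 hj'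
  have hmul : (((j * j' : ↥(unitaryGroupOfForm σ J)) : GL (Fin 3) K) : Matrix (Fin 3) (Fin 3) K) 0 0 =
      ∑ k : Fin 3, (((j : GL (Fin 3) K) : Matrix (Fin 3) (Fin 3) K) 0 k) * (((j' : GL (Fin 3) K) : Matrix (Fin 3) (Fin 3) K) k 0) := by
    rw [Subgroup.coe_mul, Units.val_mul, Matrix.mul_apply]
  rw [hmul, Fin.sum_univ_three, show ∀ a b c d : K, a + b + c - d = (a - d) + (b + c) from fun a b c d => by ring, sub_self, zero_add]
  refine Valued.v.map_add_le ?_ ?_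
  · rw [map_mul]
    calc Valued.v ((((j : ↥(unitaryGroupOfForm σ J)) : GL (Fin 3) K) : Matrix (Fin 3) (Fin 3) K) 0 1) *
          Valued.v ((((j' : ↥(unitaryGroupOfForm σ J)) : GL (Fin 3) K) : Matrix (Fin 3) (Fin 3) K) 1 0)
        ≤ 1 * Valued.v ((((j' : ↥(unitaryGroupOfForm σ J)) : GL (Fin 3) K) : Matrix (Fin 3) (Fin 3) K) 1 0) := by gcongr; exact hint 0 1
      _ ≤ Valued.v ϖ ^ n := by rw [one_mul]; exact h10'
  · rw [map_mul]
    calc Valued.v ((((j : ↥(unitaryGroupOfForm σ J)) : GL (Fin 3) K) : Matrix (Fin 3) (Fin 3) K) 0 2) *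
          Valued.v ((((j' : ↥(unitaryGroupOfForm σ J)) : GL (Fin 3) K) : Matrix (Fin 3) (Fin 3) K) 2 0)
        ≤ 1 * Valued.v ((((j' : ↥(unitaryGroupOfForm σ J)) : GL (Fin 3) K) : Matrix (Fin 3) (Fin 3) K) 2 0) := by gcongr; exact hint 0 2
      _ ≤ Valued.v ϖ ^ n := by rw [one_mul]; exact h20'

/-! ## §2 The character `j ↦ χ₁(j₀₀)` of `J_n` for `χ₁` of conductor `≤ n` -/

omit [ValuativeRel K] [(Valued.v : Valuation K ℤᵐ⁰).Compatible] in
/-- **A character of conductor `≤ n` is multiplicative modulo `𝔭ⁿ` on units**: if `χ₁ = 1` on `{u : |u − 1| ≤ |ϖ|ⁿ}`, `|a| = |b| = 1` and `|c − ab| ≤ |ϖ|ⁿ`, then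
`χ₁(c) = χ₁(a)·χ₁(b)` (`c = ab·u` with `|u − 1| = |c − ab| ≤ |ϖ|ⁿ`). [cite: Roche1998, §3] [cite: MoyPrasad1996, §3] -/
theorem chi_mk0_eq_mul_of_v_sub_le_pow (χ₁ : Kˣ →* ℂˣ) (hcond : ∀ u : Kˣ, Valued.v ((u : K) - 1) ≤ Valued.v ϖ ^ n → χ₁ u = 1)
    {a b c : K} (ha : Valued.v a = 1) (hb : Valued.v b = 1) (hc : Valued.v (c - a * b) ≤ Valued.v ϖ ^ n)
    (ha0 : a ≠ 0) (hb0 : b ≠ 0) (hc0 : c ≠ 0) :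
    χ₁ (Units.mk0 c hc0) = χ₁ (Units.mk0 a ha0) * χ₁ (Units.mk0 b hb0) := by
  have hab : Valued.v (a * b) = 1 := by rw [map_mul, ha, hb, mul_one]
  -- `u := c ∕ (ab)` is a unit congruent to `1` modulo `𝔭ⁿ`
  have hu : Valued.v (((Units.mk0 c hc0 * (Units.mk0 a ha0 * Units.mk0 b hb0)⁻¹ : Kˣ) : K) - 1) ≤ Valued.v ϖ ^ n := by
    have hval : ((Units.mk0 c hc0 * (Units.mk0 a ha0 * Units.mk0 b hb0)⁻¹ : Kˣ) : K) = c * (a * b)⁻¹ := by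
      simp only [Units.val_mul, Units.val_inv_eq_inv_val, Units.val_mk0]
    rw [hval, show c * (a * b)⁻¹ - 1 = (c - a * b) * (a * b)⁻¹ by field_simp, map_mul, map_inv₀, hab, inv_one, mul_one]
    exact hc
  have h1 := hcond _ hu
  rw [map_mul, map_inv, mul_inv_eq_one] at h1
  rw [h1, map_mul]

include hJ hvσ hvϖ hgn in
/-- The `(0,0)` entry of an element of `J_n` (`1 ≤ n`) is non-zero (it is a unit, ★ `v_apply_zero_zero_eq_one_of_mem_inf_pow`). [cite: BruhatTits1972, (4.4.4)] -/
theorem apply_zero_zero_ne_zero_of_mem_pow (hn : 1 ≤ n) {j : ↥(unitaryGroupOfForm σ J)}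
    (hj : j ∈ (glInt 3 K).subgroupOf (unitaryGroupOfForm σ J) ⊓ ((glInt 3 K).map (MulAut.conj gn).toMonoidHom).subgroupOf (unitaryGroupOfForm σ J)) :
    (((j : GL (Fin 3) K) : Matrix (Fin 3) (Fin 3) K) 0 0) ≠ 0 := by
  intro h
  have hv := K2E3IwahoriLevelNFactorisation.v_apply_zero_zero_eq_one_of_mem_inf_pow σ hJ hvσ hvϖ gn hgn hn hj
  rw [h, map_zero] at hv
  exact zero_ne_one hv

include hJ hvσ hvϖ hgn in
/-- **`θ(j) = χ₁(j₀₀)` IS MULTIPLICATIVE ON THE LEVEL-`n` IWAHORI `J_n`** (`1 ≤ n`): for `χ₁ : Kˣ → ℂˣ` of conductor `≤ n` (`χ₁ = 1` on `{u : |u − 1| ≤ |ϖ|ⁿ}`) and `j, j′ ∈ J_n`,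
`χ₁((jj′)₀₀) = χ₁(j₀₀)·χ₁(j′₀₀)` (§1 + ★ pivot + `chi_mk0_eq_mul_of_v_sub_le_pow`).  This is the character `χ̃` of Roche's pair `(J_n, χ̃)` read on the `(0,0)` entry, the level-`n`
replacement of ★ Z2A-1 `chi_apply_zero_zero_mul` in ★ V2b's letter `hθmul`. [cite: Roche1998, §3] [cite: MoyPrasad1996, §3] [cite: Casselman1995, §1.4] -/
theorem chi_apply_zero_zero_mul_pow (hn : 1 ≤ n) (χ₁ : Kˣ →* ℂˣ) (hcond : ∀ u : Kˣ, Valued.v ((u : K) - 1) ≤ Valued.v ϖ ^ n → χ₁ u = 1)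
    {j j' : ↥(unitaryGroupOfForm σ J)}
    (hj : j ∈ (glInt 3 K).subgroupOf (unitaryGroupOfForm σ J) ⊓ ((glInt 3 K).map (MulAut.conj gn).toMonoidHom).subgroupOf (unitaryGroupOfForm σ J))
    (hj' : j' ∈ (glInt 3 K).subgroupOf (unitaryGroupOfForm σ J) ⊓ ((glInt 3 K).map (MulAut.conj gn).toMonoidHom).subgroupOf (unitaryGroupOfForm σ J))
    (h0 : (((j * j' : ↥(unitaryGroupOfForm σ J)) : GL (Fin 3) K) : Matrix (Fin 3) (Fin 3) K) 0 0 ≠ 0)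
    (h1 : (((j : GL (Fin 3) K) : Matrix (Fin 3) (Fin 3) K) 0 0) ≠ 0) (h2 : (((j' : GL (Fin 3) K) : Matrix (Fin 3) (Fin 3) K) 0 0) ≠ 0) :
    χ₁ (Units.mk0 _ h0) = χ₁ (Units.mk0 _ h1) * χ₁ (Units.mk0 _ h2) :=
  chi_mk0_eq_mul_of_v_sub_le_pow χ₁ hcond
    (K2E3IwahoriLevelNFactorisation.v_apply_zero_zero_eq_one_of_mem_inf_pow σ hJ hvσ hvϖ gn hgn hn hj)
    (K2E3IwahoriLevelNFactorisation.v_apply_zero_zero_eq_one_of_mem_inf_pow σ hJ hvσ hvϖ gn hgn hn hj')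
    (v_mul_apply_zero_zero_sub_le_pow σ hJ hvσ hvϖ gn hgn hj hj') h1 h2 h0

end Summit.HodgeConjecture.HodgeConjecture.Cruxes.H413.K2E3LevelNIwahoriCharacter

end
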